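import Summits.Ventures.PercRepro.RankLevelSetHallRuleL

/-!
# PercRepro — THE MIXED RULE `(Q + L)/2`: A CONVEX COMBINATION OF FRACTIONAL `Φ`-MATCHINGS IS ONE, SO THE UP-HALL FORM
OF C-044 FOLLOWS FROM `ruleQRecv + ruleLRecv ≥ 2Φ` (p4, gen 31; C-044, UP form at the tight layer; paper
proofs/P4-CELL-THREE.md §14.15 REMARK)

Rule Q (the equal split among the members of every `Y`-set, night-1 g13) and Rule L (the LYM split on the middle
levels and the equal split among the ELIGIBLE members of the big sets, night-1 g15) have complementary weaknesses: Rule Q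
is refuted on the model `T_p(U_{q,q+m} ⊕ free)` at large flat parts (night-1 g20), where Rule L pays `55 … 958 Φ`; Rule L is
tightest on the members with one flat point and a small circuit (margin `1.149` at `(q,k,m) = (4,6,1)`, kit j318246),
where Rule Q pays `≥ 2.7 Φ`.  Any convex combination of two fractional matchings with loads `≤ 1` is a fractional matching
with loads `≤ 1`, so night-1's double count `hallUp_of_fracMatching` applies to the average of the two weights: if every
member receives at least `2Φ(p,q)` from the two rules together (`MixedUp`, a `Prop`, NOT asserted), the UP-Hall
condition holds for every family of members.  `MixedUp` is implied by `RuleQUp ∧ RuleLUp` and is weaker than either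
conjecture on its own wherever the other rule has slack.
* `ruleQWeight` — Rule Q as a weight on pairs `(Z, S)`; `ruleQWeight_recv` (its receipt is `ruleQRecv`),
  `ruleQWeight_load_le_one` (every `Y`-set loaded at most `1`);
* `hallUp_of_two_fracMatchings` — the general statement for two weights;
* `MixedUp`, **`hallUp_of_ncard_eq_of_mixed`** — `#E = p + q`, `MixedUp M p q` ⇒ the UP-Hall condition for every family;
* `mixedUp_of_ruleQUp_of_ruleLUp`.
Axioms standard.
-/

namespace PercRepro

open Set Matroid Finset

variable {α : Type} (M : Matroid α) [M.Finite]

/-- **Rule Q as a weight**: a member `Z` inside the `Y`-set `S` receives `1 / m(S)`, where `m(S)` is the number of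
members inside `S` (`memCount`); `0` otherwise. -/
noncomputable def ruleQWeight (p q : ℕ) (Z S : Set α) : ℚ := by
  classical
  exact if Z ∈ cellMembers M p q ∧ Z ⊆ S ∧ S ∈ cellY M p q then 1 / ((memCount M p q S : ℕ) : ℚ) else 0

omit [M.Finite] in
/-- Rule Q's weights are non-negative. -/
theorem ruleQWeight_nonneg (p q : ℕ) (Z S : Set α) : 0 ≤ ruleQWeight M p q Z S := by
  unfold ruleQWeight
  split_ifs <;> positivity

omit [M.Finite] in
/-- Rule Q's weights are supported on the pairs `Z ⊆ S`. -/
theorem subset_of_ruleQWeight_ne_zero (p q : ℕ) (Z S : Set α) (h : ruleQWeight M p q Z S ≠ 0) : Z ⊆ S := by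
  unfold ruleQWeight at h
  split_ifs at h with hc
  · exact hc.2.1
  · exact absurd rfl h

/-- The receipt of a member under the weight `ruleQWeight` is `ruleQRecv`. -/
theorem ruleQWeight_recv (p q : ℕ) {Z : Set α} (hZ : Z ∈ cellMembers M p q) :
    ∑ S ∈ (cellY_finite M p q).toFinset, ruleQWeight M p q Z S = ruleQRecv M p q Z := by
  classical
  unfold ruleQRecv
  refine Finset.sum_congr rfl (fun S hS => ?_)
  rw [(cellY_finite M p q).mem_toFinset] at hS
  unfold ruleQWeight
  simp only [Set.indicator_apply, Set.mem_setOf_eq]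
  by_cases hZS : Z ⊆ S
  · simp [hZ, hZS, hS]
  · simp [hZS]

/-- **Every `Y`-set is loaded at most `1` under Rule Q**: the members inside `S` share one unit equally. -/
theorem ruleQWeight_load_le_one (p q : ℕ) {S : Set α} (hS : S ∈ cellY M p q) :
    ∑ Z ∈ (cellMembers_finite M p q).toFinset, ruleQWeight M p q Z S ≤ 1 := by
  classical
  set Mf : Finset (Set α) := (cellMembers_finite M p q).toFinset with hMf
  have hmem : ∀ Z, Z ∈ Mf ↔ Z ∈ cellMembers M p q := fun Z => by
    rw [hMf, (cellMembers_finite M p q).mem_toFinset]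
  have hcount : memCount M p q S = (Mf.filter (fun Z => Z ⊆ S)).card := by
    unfold memCount
    rw [Set.ncard_eq_toFinset_card _ ((cellMembers_finite M p q).subset (fun _ h => h.1))]
    congr 1
    ext Z
    rw [Set.Finite.mem_toFinset, Finset.mem_filter, hmem, Set.mem_setOf_eq]
  have hsum : ∑ Z ∈ Mf, ruleQWeight M p q Z S
      = ∑ Z ∈ Mf.filter (fun Z => Z ⊆ S), 1 / ((memCount M p q S : ℕ) : ℚ) := by
    rw [Finset.sum_filter]
    refine Finset.sum_congr rfl (fun Z hZ => ?_)
    rw [hmem] at hZ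
    unfold ruleQWeight
    by_cases hZS : Z ⊆ S
    · simp [hZ, hZS, hS]
    · simp [hZS]
  rw [hsum, Finset.sum_const, nsmul_eq_mul, hcount]
  by_cases hpos : (Mf.filter (fun Z => Z ⊆ S)).card = 0
  · rw [hpos]; simp
  · have hpos' : (0 : ℚ) < ((Mf.filter (fun Z => Z ⊆ S)).card : ℚ) := by
      exact_mod_cast Nat.pos_of_ne_zero hpos
    rw [mul_one_div, div_self hpos'.ne']

/-- **Two fractional `Φ`-matchings average to one**: if two non-negative weights supported on the pairs `Z ⊆ S` each
load every `Y`-set at most `1`, and every member receives at least `2Φ(p,q)` from the two together, then the UP-Hall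
condition holds for every family of members. -/
theorem hallUp_of_two_fracMatchings (p q : ℕ) (w₁ w₂ : Set α → Set α → ℚ)
    (hnn₁ : ∀ Z S, 0 ≤ w₁ Z S) (hnn₂ : ∀ Z S, 0 ≤ w₂ Z S)
    (hsupp₁ : ∀ Z S, w₁ Z S ≠ 0 → Z ⊆ S) (hsupp₂ : ∀ Z S, w₂ Z S ≠ 0 → Z ⊆ S)
    (hdem : ∀ Z ∈ cellMembers M p q, 2 * phiK p q ≤
      ∑ S ∈ (cellY_finite M p q).toFinset, w₁ Z S + ∑ S ∈ (cellY_finite M p q).toFinset, w₂ Z S)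
    (hcap₁ : ∀ S ∈ cellY M p q, ∑ Z ∈ (cellMembers_finite M p q).toFinset, w₁ Z S ≤ 1)
    (hcap₂ : ∀ S ∈ cellY M p q, ∑ Z ∈ (cellMembers_finite M p q).toFinset, w₂ Z S ≤ 1)
    (𝒜 : Set (Set α)) (h𝒜 : 𝒜 ⊆ cellMembers M p q) :
    phiK p q * (𝒜.ncard : ℚ) ≤ ((upNbhd M p q 𝒜).ncard : ℚ) := by
  refine hallUp_of_fracMatching M p q (fun Z S => (w₁ Z S + w₂ Z S) / 2) ?_ ?_ ?_ ?_ 𝒜 h𝒜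
  · intro Z S
    have := hnn₁ Z S; have := hnn₂ Z S
    positivity
  · intro Z S h
    by_cases h₁ : w₁ Z S = 0
    · have h₂ : w₂ Z S ≠ 0 := by
        intro h₂; apply h; rw [h₁, h₂]; norm_num
      exact hsupp₂ Z S h₂
    · exact hsupp₁ Z S h₁
  · intro Z hZ
    have h := hdem Z hZ
    rw [← Finset.sum_div, Finset.sum_add_distrib, le_div_iff₀ (by norm_num : (0 : ℚ) < 2)]
    linarith
  · intro S hS
    rw [← Finset.sum_div, Finset.sum_add_distrib, div_le_one (by norm_num : (0 : ℚ) < 2)]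
    linarith [hcap₁ S hS, hcap₂ S hS]

/-- **The mixed rule** `(Q + L)/2` pays every member (a `Prop`; NOT asserted): `ruleQRecv Z + ruleLRecv Z ≥ 2Φ(p,q)`
for every member `Z` — implied by `RuleQUp ∧ RuleLUp`, weaker than either alone wherever the other has slack. -/
def MixedUp (p q : ℕ) : Prop :=
  ∀ Z ∈ cellMembers M p q, 2 * phiK p q ≤ ruleQRecv M p q Z + ruleLRecv M p q Z

/-- **C-044, UP FORM, AT THE TIGHT LAYER FROM THE MIXED RULE**: `#E = p + q` and `MixedUp M p q` ⇒ every family of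
members has at least `Φ(p,q)·#𝒜` UP-neighbours. -/
theorem hallUp_of_ncard_eq_of_mixed (p q : ℕ) (hE : M.E.ncard = p + q) (h : MixedUp M p q)
    (𝒜 : Set (Set α)) (h𝒜 : 𝒜 ⊆ cellMembers M p q) :
    phiK p q * (𝒜.ncard : ℚ) ≤ ((upNbhd M p q 𝒜).ncard : ℚ) := by
  refine hallUp_of_two_fracMatchings M p q (ruleQWeight M p q) (ruleLWeight M p q)
    (ruleQWeight_nonneg M p q) (ruleLWeight_nonneg M p q)
    (subset_of_ruleQWeight_ne_zero M p q) (subset_of_ruleLWeight_ne_zero M p q) ?_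
    (fun S hS => ruleQWeight_load_le_one M p q hS) (fun S hS => ruleLWeight_load_le_one M hE S hS) 𝒜 h𝒜
  intro Z hZ
  rw [ruleQWeight_recv M p q hZ]
  exact h Z hZ

/-- `RuleQUp ∧ RuleLUp ⇒ MixedUp`. -/
theorem mixedUp_of_ruleQUp_of_ruleLUp (p q : ℕ) (hQ : RuleQUp M p q) (hL : RuleLUp M p q) : MixedUp M p q := by
  intro Z hZ
  have h1 := hQ Z hZ
  have h2 := hL Z hZ
  linarith

end PercRepro
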